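import Summits.HubbardSuperconductivity.HubbardSuperconductivity.Theorems.AnisotropyChordTransferFibre3FinX3Eval

/-!
# Route `AnisotropyChord` / H0 rotor rung: FIN per-`L` GM₃ for `33 ≤ L ≤ 47` — the X5 row-C evaluator on profile POINT WEDGES (computable, zero data)

For `L ≥ 33` the `O(L³)` profile / gradient CELL tables of g4/g5 (`fTab4`, `gTab4`) no longer fit one kernel `decide` (≈150 s-equivalent
work ceiling, g4 §6; measured 72 s-equiv at `L = 28`, `∝ L³`).  THIS FILE replaces them by POINT WEDGES of the torus Green function:
`gWedgePt L lam` = the row–column table of `G̃_λ(r₁,r₂)` at the rational point `λ = lam/D` restricted to the `D₄` wedge `0 ≤ r₂ ≤ r₁ ≤ L/2`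
(half inner tables `aTabH`, wedge outer loop: ≈ 30 % of the work of `gresRCTab`, one declaration per GRID POINT, shared by the two
adjacent cells, exactly like the XB2 point wedges `tWedgePt`).  On a λ-cell `[la, lb]` the profile is enclosed from the TWO point wedges by
MONOTONICITY: `a_λ(r) := G̃_λ(0) − G̃_λ(r) = (1/V)Σ_p (1 − cos p·r)·g_λ(p)` has nonnegative weights and `g_λ(p) = 1/(2ε(p) − λ)` increases
with `λ`, so `a_λ(r) ∈ [a_{la}(r), a_{lb}(r)]` (proved in `…FinX5Tables`); `f = Δf_nn + c_s·a_λ` off the origin (`fTabA`), `D_x f = c_s·(a_λ(r) −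
a_λ(r − x̂))` (`gTabA`; at the two core sites from the profile table).  The row-C objects / certificate are g5's on these tables
(`…FinX3Eval.xcObjT` / `xcCellOKT` take the tables as arguments): ★ `xcCellOKA`, `xcCellAnyTA`, `xcCellAnyA0`, and the GM₃ glue predicates
`gmCellOK5` / `cellsAllG5` / `gmCheck5` on the X4 cell record `GCell4` (row `N₁` fact exporting `nt`, `tb` unchanged; rows D and side unchanged).
Float mirror (x5study.py, validated against the kernel's `b_min` to 3 digits at `L = 25`): gradients as differences of the monotone point
tables cost ≤ 2 % in the row-C constant `b` against `gTab4`.  Soundness: `…FinX5Green` (wedge encloses `G̃`), `…FinX5Tables` (monotonicity,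
`TabEncl` of `fTabA`, gradient enclosure of `gTabA`), `…FinX5Sound` (cell certificate, glue ★★★ `gm3_of_gmCheck5`).
Prover seat `hubbard-h0-rotor-p3` g8; helper for piece A = stmt-HubbardSuperconductivity-23918 of rung 19089 (`--supports`, helper
class).  WHAT THIS IS NOT: nothing here proves superconductivity in the Hubbard model (rotor TARGET as worded stays FALSE, g15 verdict);
evaluator infrastructure for the FIN certificates of ONE conditional reduction.  Tree imports only; no sorry, no new axioms.
-/

set_option linter.dupNamespace false
set_option autoImplicit false

namespace Summit.HubbardSuperconductivity.HubbardSuperconductivity.Theorems.AnisotropyChord.Transfer.Fibre3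

namespace FinCell

open Hole2

/-! ## The Green point wedge -/

/-- the HALF transposed inner table: rows `r₂ ∈ [0, L/2]`, entry `k₁` = `Σ_{k₂} t(k₂r₂)·w(k₁,k₂)`. -/
def aTabH (L : ℕ) (trows etz : List (List Iv)) : List (List Iv) :=
  (List.range (L / 2 + 1)).map fun r2 => (List.range L).map fun k1 => dot (trows.getD r2 []) (etz.getD k1 [])

/-- ★ THE GREEN POINT WEDGE at `λ·D = lam`: row `r₁ ∈ [0, L/2]`, entries `r₂ ∈ [0, r₁]` = `G̃_λ(r₁,r₂)` (row–column sums, scale `D`). -/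
def gWedgePt (L : ℕ) (lam : ℤ) : List (List Iv) :=
  let ct := cosTab L
  let st := sinTab L
  let et := etZ (gresCellTab L ct lam lam)
  let cr := trigRows L ct
  let sr := trigRows L st
  let ac := aTabH L cr et
  let bc := aTabH L sr et
  (List.range (L / 2 + 1)).map fun r1 => (List.range (r1 + 1)).map fun r2 =>
    rcEntry L (cr.getD r1 []) (sr.getD r1 []) (ac.getD r2 []) (bc.getD r2 [])

/-- wedge lookup with `D₄` folding: `G̃(r₁,r₂) = G̃(fold r₁, fold r₂)` (mirror) `= G̃(r₂,r₁)` (swap). -/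
def gW (L : ℕ) (w : List (List Iv)) (r1 r2 : ℕ) : Iv :=
  let a := FinXB.fold L r1
  let b := FinXB.fold L r2
  if b ≤ a then FinXB.getT w a b else FinXB.getT w b a

/-! ## Profile and gradient tables of a cell from the two point wedges -/

/-- the enclosure of `a_λ(r) = G̃_λ(0) − G̃_λ(r)` on the cell from the point wedges at `la` (`wLo`) and `lb` (`wHi`) (monotone in `λ`). -/
def aIvA (L : ℕ) (la lb : ℤ) (wLo wHi : List (List Iv)) (r1 r2 : ℕ) : Iv :=
  ((G0Iv L la la).1 - (gW L wLo r1 r2).2, (G0Iv L lb lb).2 - (gW L wHi r1 r2).1)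

/-- ★ the profile table of the cell: `0` at the origin, `Δf_nn + c_s·a_λ(r)` elsewhere. -/
def fTabA (L : ℕ) (la lb : ℤ) (wLo wHi : List (List Iv)) : List (List Iv) :=
  mkTab L fun r1 r2 => if r1 = 0 ∧ r2 = 0 then (0, 0) else iadd (dfnnIv L la lb) (imul (csIv L la lb) (aIvA L la lb wLo wHi r1 r2))

/-- ★ the `x̂`-gradient table of the cell: `f(r) − f(r − x̂)` from the profile table at the two core sites (`r = 0` or `r − x̂ = 0`),
`c_s·(a_λ(r) − a_λ(r − x̂))` (difference of the monotone enclosures) elsewhere. -/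
def gTabA (L : ℕ) (la lb : ℤ) (wLo wHi ft : List (List Iv)) : List (List Iv) :=
  mkTab L fun r1 r2 =>
    if (r1 = 0 ∧ r2 = 0) ∨ (subm L r1 1 = 0 ∧ subm L r2 0 = 0) then
      isub (getF ft r1 r2) (getF ft (subm L r1 1) (subm L r2 0))
    else
      imul (csIv L la lb)
        ((aIvA L la lb wLo wHi r1 r2).1 - (aIvA L la lb wLo wHi (subm L r1 1) r2).2,
         (aIvA L la lb wLo wHi r1 r2).2 - (aIvA L la lb wLo wHi (subm L r1 1) r2).1)

end FinCell

namespace FinXB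

open Hole2 FinCell

/-! ## The row-C certificate on the point wedges -/

/-- ★ THE X5 ROW-C CELL CERTIFICATE (constant `b = bn/bd`, `T⁺·D` brackets `tb` from the row-`N₁` fact), given the two Green point
wedges: positive point denominators at both ends, then g5's row-C certificate `xcCellOKT` on the tables `fTabA` / `gTabA`. -/
def xcCellOKA (L : ℕ) (la lb : ℤ) (bn bd : ℕ) (tb : ℤ × ℤ) (wLo wHi : List (List Iv)) : Bool :=
  let ft := fTabA L la lb wLo wHi
  denCellPos L (cosTab L) la la && denCellPos L (cosTab L) lb lb && decide (0 < la) &&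
    xcCellOKT L la lb bn bd tb ft (gTabA L la lb wLo wHi ft)

/-- one row-C cell, given the wedges: vacuous or certified. -/
def xcCellAnyTA (L : ℕ) (d1 : ℚ) (bd : ℕ) (la lb : ℤ) (bn : ℕ) (tb : ℤ × ℤ) (wLo wHi : List (List Iv)) : Bool :=
  (denCellPos L (cosTab L) la lb && decide ((numIv L la lb).2 < 0) && decide (0 ≤ (G0Iv L la lb).1)) ||
  (groundCellCheck L la lb &&
    (decide ((deltaIv L la lb).2 < 0) || decide (d1 * (D : ℚ) < (((deltaIv L la lb).1 : ℤ) : ℚ)))) ||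
  xcCellOKA L la lb bn bd tb wLo wHi

/-- ★ one row-C cell with the point wedges recomputed (kernel facts rewrite `gWedgePt L la`, `gWedgePt L lb` to certified literals). -/
def xcCellAnyA0 (L : ℕ) (d1 : ℚ) (bd : ℕ) (la lb : ℤ) (bn : ℕ) (tb : ℤ × ℤ) : Bool :=
  xcCellAnyTA L d1 bd la lb bn tb (gWedgePt L la) (gWedgePt L lb)

end FinXB

namespace FinXD

open Hole2 FinCell FinXB

/-! ## The GM₃ cell list (X5 form: row C on point wedges; rows `N₁`, D, side as in X4) -/

/-- the per-pair check (X5 form). -/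
def gmCellOK5 (L : ℕ) (d1 : ℚ) (bd : ℕ) (a : GCell4) (next : ℤ) : Bool :=
  xbnCellAny2 L d1 a.lam next a.c (a.nlo, a.nhi) (a.tlo, a.thi) && xcCellAnyA0 L d1 bd a.lam next a.bn (a.tlo, a.thi) &&
    xdCellAnyN0 L d1 a.lam next a.aD (a.nlo, a.nhi) && sdCellAnyZN L d1 bd a.lam next (a.c, a.bn, a.aD) (a.nlo, a.nhi)

/-- all consecutive pairs pass (X5 form). -/
def cellsAllG5 (L : ℕ) (d1 : ℚ) (bd : ℕ) : List GCell4 → Bool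
  | [] => true
  | [_] => true
  | a :: b :: rest => gmCellOK5 L d1 bd a b.lam && cellsAllG5 L d1 bd (b :: rest)

/-- ★ THE PER-`L` GM₃ CERTIFICATE (X5 form) on `0 < Δ ≤ Δ₁`: points start at `0`, end `≥ lamTop L`, `0 < bd`, every pair passes. -/
def gmCheck5 (L : ℕ) (d1 : ℚ) (bd : ℕ) (cells : List GCell4) : Bool :=
  decide ((cells.head?.map GCell4.lam) = some 0) && decide (2 ≤ cells.length) && decide (lamTop L ≤ cellsLastG4 cells)
    && decide (0 < bd) && cellsAllG5 L d1 bd cells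

end FinXD

end Summit.HubbardSuperconductivity.HubbardSuperconductivity.Theorems.AnisotropyChord.Transfer.Fibre3
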